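import Summits.AtomisticToContinuum.FouriersLaw.Theses.EmbeddedDrudeMourre
import Summits.AtomisticToContinuum.FouriersLaw.Theorems.EmbeddedDrudeMourreMourreDissolutionCosineBochner
import Summits.AtomisticToContinuum.FouriersLaw.Theorems.EmbeddedDrudeMourreDrudeDissolutionStubFreeForceKernelReduction
import Literature.MathematicalPhysics.KineticTheory.ZeroWavenumberSpace
import Literature.MathematicalPhysics.KineticTheory.InfiniteChainInvariantStates
import Literature.MathematicalPhysics.KineticTheory.InfiniteChainSuperstableDynamics
import HarnessLib

/-!
# Stub K `stub_freeForceKernel`, the free force kernel is a cosine transform (Bochner)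
(line `gram-pencil-harmonic-chaos`, crux `EmbeddedDrudeMourre.DrudeDissolution`,
item stmt-AtomisticToContinuum-12593; `--supports` file, closes nothing)

WHAT. For ANY zero-wavenumber datum `Z` over a chain dynamics `D` with strongly continuous Koopman
group and any local observable `a`, the autocorrelation `t ↦ Z.form a (a ∘ φ_t) = ⟪[a], U_t[a]⟫₀` is
continuous, even and positive semidefinite, hence (Bochner, `MourreDissolution.stub_cosineBochner`) the
cosine transform of a finite measure — the spectral measure of the class `[a]`
(`form_comp_flow_eq_cosTransform`, registered helper). Specialised to the data of stub K
(`freeForceKernel_eq_cosTransform`): the free force kernel `K₀(t) = Z₀.form Φ (Φ ∘ φ⁰_t)` of the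
first-order force `Φ` IS `∫ cos(xt) dm_Φ(x)` for a finite measure `m_Φ`. Consequently the only open
content of stub K is the WINDOW clause of its spectral form
(`stub_freeForceKernel_of_spectralWindow`, landed): near frequency `0`, `m_Φ` (equivalently its
symmetrisation) has a continuous non-negative density, positive at `0` — the Wick/normal-mode
identification of `m_Φ` plus the two-phonon threshold analysis of the line's plan
(`stub_freeForceKernel_of_windowDensity` records this residual form).
-/

noncomputable section

open MeasureTheory Filter Set Function Topology
open scoped InnerProductSpace ENNReal NNReal
open Literature.MathematicalPhysics.KineticTheory
open Literature.MathematicalPhysics.KineticTheory.HeatConduction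
open Literature.MathematicalPhysics.KineticTheory.PhononBoltzmann

namespace Summit.AtomisticToContinuum.FouriersLaw.Theorems.DrudeDissolution.GramPencilHarmonicChaos

/-- **Registered helper (stub K): autocorrelations of a zero-wavenumber datum are cosine transforms.**
For a zero-wavenumber datum `Z` over a chain dynamics `D` with strongly continuous Koopman group and
`a ∈ Z.localObs`, there is a finite measure `m` on `ℝ` (the spectral measure of `[a]`) with
`Z.form a (a ∘ φ_t) = ∫ cos(xt) dm(x)` for all `t`. [folklore] -/
theorem form_comp_flow_eq_cosTransform : ∀ (P : Literature.MathematicalPhysics.KineticTheory.HeatConduction.OscillatorChain) (D : Literature.MathematicalPhysics.KineticTheory.HeatConduction.InfiniteChainDynamics P) (Z : Literature.MathematicalPhysics.KineticTheory.HeatConduction.ZeroWavenumberData P D), Z.toFluctuationDynamics.IsStronglyContinuous → ∀ a ∈ Z.localObs, ∃ m : MeasureTheory.Measure ℝ, MeasureTheory.IsFiniteMeasure m ∧ ∀ t : ℝ, Z.form a (a ∘ D.flow t) = ∫ x, Real.cos (x * t) ∂m := by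
  intro P D Z hsc a ha
  -- the autocorrelation as a matrix coefficient of the Koopman group
  set C : ℝ → ℝ := fun t => ⟪Z.fluct a, Z.koopman t (Z.fluct a)⟫_ℝ with hC
  have hCform : ∀ t : ℝ, C t = Z.form a (a ∘ D.flow t) := fun t =>
    Z.toFluctuationDynamics.inner_fluct_koopman_fluct t ha ha
  have hcont : Continuous C := continuous_const.inner (hsc (Z.fluct a))
  have heven : ∀ t : ℝ, C (-t) = C t := fun t =>
    Z.toFluctuationDynamics.inner_koopman_neg_apply t (Z.fluct a)
  have hpsd : ∀ (n : ℕ) (c τ : Fin n → ℝ), 0 ≤ ∑ i, ∑ j, c i * c j * C (τ j - τ i) :=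
    fun n c τ => Z.toFluctuationDynamics.sum_mul_inner_koopman_nonneg Finset.univ c τ (Z.fluct a)
  obtain ⟨m, hm, hrep⟩ := MourreDissolution.stub_cosineBochner C hcont heven hpsd
  exact ⟨m, hm, fun t => by rw [← hCform t, hrep t]⟩

/-- Evenness and the a priori bound of such autocorrelations: `K(−t) = K(t)` and `|K(t)| ≤ K(0)`.
[folklore] -/
theorem form_comp_flow_even_and_abs_le {P : OscillatorChain} {D : InfiniteChainDynamics P}
    (Z : ZeroWavenumberData P D) {a : ChainConfig → ℝ} (ha : a ∈ Z.localObs) (t : ℝ) :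
    Z.form a (a ∘ D.flow (-t)) = Z.form a (a ∘ D.flow t) ∧
      |Z.form a (a ∘ D.flow t)| ≤ Z.form a (a ∘ D.flow 0) := by
  set C : ℝ → ℝ := fun t => ⟪Z.fluct a, Z.koopman t (Z.fluct a)⟫_ℝ with hC
  have hCform : ∀ s : ℝ, C s = Z.form a (a ∘ D.flow s) := fun s =>
    Z.toFluctuationDynamics.inner_fluct_koopman_fluct s ha ha
  have heven : ∀ s : ℝ, C (-s) = C s := fun s =>
    Z.toFluctuationDynamics.inner_koopman_neg_apply s (Z.fluct a)
  have hpsd : ∀ (n : ℕ) (c τ : Fin n → ℝ), 0 ≤ ∑ i, ∑ j, c i * c j * C (τ j - τ i) :=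
    fun n c τ => Z.toFluctuationDynamics.sum_mul_inner_koopman_nonneg Finset.univ c τ (Z.fluct a)
  have h1 := heven t
  have h2 := MourreDissolution.abs_le_apply_zero heven hpsd t
  rw [hCform, hCform] at h1 h2
  exact ⟨h1, h2⟩

/-- **The free force kernel of stub K is a cosine transform.** For the data of stub K (indeed for any
datum with strongly continuous Koopman group containing `Φ` among its observables), there is a finite
measure `m_Φ` with `Z₀.form Φ (Φ ∘ φ⁰_t) = ∫ cos(xt) dm_Φ(x)` for all `t`. [folklore] -/
theorem freeForceKernel_eq_cosTransform (ω₂ a b : ℝ)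
    (D₀ : InfiniteChainDynamics (pinnedChain ω₂ 0 0 1)) (Z₀ : ZeroWavenumberData (pinnedChain ω₂ 0 0 1) D₀)
    (hsc : Z₀.toFluctuationDynamics.IsStronglyContinuous)
    (hΦ : (fun σ : ChainConfig => liouvilleZ (pinnedChain ω₂ a b 1) (fun σ => (pinnedChain ω₂ 0 0 1).bondCurrentZ σ 0) σ - liouvilleZ (pinnedChain ω₂ 0 0 1) (fun σ => (pinnedChain ω₂ 0 0 1).bondCurrentZ σ 0) σ + b * (liouvilleZ (pinnedChain ω₂ 0 0 1) (fun σ => (pinnedChain ω₂ 0 1 1).bondCurrentZ σ 0) σ - liouvilleZ (pinnedChain ω₂ 0 0 1) (fun σ => (pinnedChain ω₂ 0 0 1).bondCurrentZ σ 0) σ)) ∈ Z₀.localObs) :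
    ∃ m : Measure ℝ, IsFiniteMeasure m ∧ ∀ t : ℝ,
      Z₀.form
          (fun σ : ChainConfig => liouvilleZ (pinnedChain ω₂ a b 1) (fun σ => (pinnedChain ω₂ 0 0 1).bondCurrentZ σ 0) σ - liouvilleZ (pinnedChain ω₂ 0 0 1) (fun σ => (pinnedChain ω₂ 0 0 1).bondCurrentZ σ 0) σ + b * (liouvilleZ (pinnedChain ω₂ 0 0 1) (fun σ => (pinnedChain ω₂ 0 1 1).bondCurrentZ σ 0) σ - liouvilleZ (pinnedChain ω₂ 0 0 1) (fun σ => (pinnedChain ω₂ 0 0 1).bondCurrentZ σ 0) σ))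
          ((fun σ : ChainConfig => liouvilleZ (pinnedChain ω₂ a b 1) (fun σ => (pinnedChain ω₂ 0 0 1).bondCurrentZ σ 0) σ - liouvilleZ (pinnedChain ω₂ 0 0 1) (fun σ => (pinnedChain ω₂ 0 0 1).bondCurrentZ σ 0) σ + b * (liouvilleZ (pinnedChain ω₂ 0 0 1) (fun σ => (pinnedChain ω₂ 0 1 1).bondCurrentZ σ 0) σ - liouvilleZ (pinnedChain ω₂ 0 0 1) (fun σ => (pinnedChain ω₂ 0 0 1).bondCurrentZ σ 0) σ)) ∘ D₀.flow t) =
        ∫ x, Real.cos (x * t) ∂m :=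
  form_comp_flow_eq_cosTransform _ D₀ Z₀ hsc _ hΦ

/-- **Stub K from the window clause alone.** Since a representing measure for the free force
kernel always exists (`freeForceKernel_eq_cosTransform`), stub K follows as soon as, GIVEN any finite
measure `m` with `K₀(t) = ∫ cos(xt) dm(x)`, one can exhibit a finite measure `m'` with the same cosine
transform (e.g. `m` itself, its symmetrisation, or the explicit Wick/normal-mode spectral measure of
`[Φ]`) carrying on a window `(−δ, δ)` a continuous non-negative density, positive at `0`. This is the
residual of stub K left open by this line's helper files (Wick dictionary + two-phonon threshold
analysis); pure logic over `stub_freeForceKernel_of_spectralWindow`. [folklore] -/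
theorem stub_freeForceKernel_of_windowDensity
    (hwin : ∀ ω₂ a b : ℝ, 0 < ω₂ → 0 < a → 0 < b → HasOddSectorGap ω₂ a b →
      ∀ (D₀ : InfiniteChainDynamics (pinnedChain ω₂ 0 0 1)) (Z₀ : ZeroWavenumberData (pinnedChain ω₂ 0 0 1) D₀),
        (pinnedChain ω₂ 0 0 1).IsChainGibbsMeasure 1 Z₀.μ →
        D₀.carrier = (pinnedChain ω₂ 0 0 1).bmGood →
        Z₀.toFluctuationDynamics.IsStronglyContinuous →
        (fun σ : ChainConfig => liouvilleZ (pinnedChain ω₂ a b 1) (fun σ => (pinnedChain ω₂ 0 0 1).bondCurrentZ σ 0) σ - liouvilleZ (pinnedChain ω₂ 0 0 1) (fun σ => (pinnedChain ω₂ 0 0 1).bondCurrentZ σ 0) σ + b * (liouvilleZ (pinnedChain ω₂ 0 0 1) (fun σ => (pinnedChain ω₂ 0 1 1).bondCurrentZ σ 0) σ - liouvilleZ (pinnedChain ω₂ 0 0 1) (fun σ => (pinnedChain ω₂ 0 0 1).bondCurrentZ σ 0) σ)) ∈ Z₀.localObs →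
        ∀ m : Measure ℝ, IsFiniteMeasure m →
          (∀ t : ℝ, Z₀.form
                (fun σ : ChainConfig => liouvilleZ (pinnedChain ω₂ a b 1) (fun σ => (pinnedChain ω₂ 0 0 1).bondCurrentZ σ 0) σ - liouvilleZ (pinnedChain ω₂ 0 0 1) (fun σ => (pinnedChain ω₂ 0 0 1).bondCurrentZ σ 0) σ + b * (liouvilleZ (pinnedChain ω₂ 0 0 1) (fun σ => (pinnedChain ω₂ 0 1 1).bondCurrentZ σ 0) σ - liouvilleZ (pinnedChain ω₂ 0 0 1) (fun σ => (pinnedChain ω₂ 0 0 1).bondCurrentZ σ 0) σ))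
                ((fun σ : ChainConfig => liouvilleZ (pinnedChain ω₂ a b 1) (fun σ => (pinnedChain ω₂ 0 0 1).bondCurrentZ σ 0) σ - liouvilleZ (pinnedChain ω₂ 0 0 1) (fun σ => (pinnedChain ω₂ 0 0 1).bondCurrentZ σ 0) σ + b * (liouvilleZ (pinnedChain ω₂ 0 0 1) (fun σ => (pinnedChain ω₂ 0 1 1).bondCurrentZ σ 0) σ - liouvilleZ (pinnedChain ω₂ 0 0 1) (fun σ => (pinnedChain ω₂ 0 0 1).bondCurrentZ σ 0) σ)) ∘ D₀.flow t) =
              ∫ x, Real.cos (x * t) ∂m) →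
          ∃ m' : Measure ℝ, IsFiniteMeasure m' ∧
            (∀ t : ℝ, ∫ x, Real.cos (x * t) ∂m' = ∫ x, Real.cos (x * t) ∂m) ∧
            ∃ δ : ℝ, 0 < δ ∧ ∃ ρ : ℝ → ℝ, ContinuousOn ρ (Set.Ioo (-δ) δ) ∧ (∀ x ∈ Set.Ioo (-δ) δ, 0 ≤ ρ x) ∧
              0 < ρ 0 ∧
              m'.restrict (Set.Ioo (-δ) δ) = (volume.restrict (Set.Ioo (-δ) δ)).withDensity (fun x => ENNReal.ofReal (ρ x))) :
    ∀ ω₂ a b : ℝ, 0 < ω₂ → 0 < a → 0 < b → HasOddSectorGap ω₂ a b →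
      ∀ (D₀ : InfiniteChainDynamics (pinnedChain ω₂ 0 0 1)) (Z₀ : ZeroWavenumberData (pinnedChain ω₂ 0 0 1) D₀),
        (pinnedChain ω₂ 0 0 1).IsChainGibbsMeasure 1 Z₀.μ →
        D₀.carrier = (pinnedChain ω₂ 0 0 1).bmGood →
        Z₀.toFluctuationDynamics.IsStronglyContinuous →
        (fun σ : ChainConfig => liouvilleZ (pinnedChain ω₂ a b 1) (fun σ => (pinnedChain ω₂ 0 0 1).bondCurrentZ σ 0) σ - liouvilleZ (pinnedChain ω₂ 0 0 1) (fun σ => (pinnedChain ω₂ 0 0 1).bondCurrentZ σ 0) σ + b * (liouvilleZ (pinnedChain ω₂ 0 0 1) (fun σ => (pinnedChain ω₂ 0 1 1).bondCurrentZ σ 0) σ - liouvilleZ (pinnedChain ω₂ 0 0 1) (fun σ => (pinnedChain ω₂ 0 0 1).bondCurrentZ σ 0) σ)) ∈ Z₀.localObs →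
        ∃ δ : ℝ, 0 < δ ∧ ∃ ρ : ℝ → ℝ, ContinuousOn ρ (Set.Ioo (-δ) δ) ∧ 0 < ρ 0 ∧
          TendstoLocallyUniformlyOn
            (fun (ν : ℝ) (ω : ℝ) => ∫ t in Set.Ioi (0 : ℝ), Real.exp (-(ν * t)) * (Real.cos (ω * t) *
              Z₀.form
                (fun σ : ChainConfig => liouvilleZ (pinnedChain ω₂ a b 1) (fun σ => (pinnedChain ω₂ 0 0 1).bondCurrentZ σ 0) σ - liouvilleZ (pinnedChain ω₂ 0 0 1) (fun σ => (pinnedChain ω₂ 0 0 1).bondCurrentZ σ 0) σ + b * (liouvilleZ (pinnedChain ω₂ 0 0 1) (fun σ => (pinnedChain ω₂ 0 1 1).bondCurrentZ σ 0) σ - liouvilleZ (pinnedChain ω₂ 0 0 1) (fun σ => (pinnedChain ω₂ 0 0 1).bondCurrentZ σ 0) σ))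
                ((fun σ : ChainConfig => liouvilleZ (pinnedChain ω₂ a b 1) (fun σ => (pinnedChain ω₂ 0 0 1).bondCurrentZ σ 0) σ - liouvilleZ (pinnedChain ω₂ 0 0 1) (fun σ => (pinnedChain ω₂ 0 0 1).bondCurrentZ σ 0) σ + b * (liouvilleZ (pinnedChain ω₂ 0 0 1) (fun σ => (pinnedChain ω₂ 0 1 1).bondCurrentZ σ 0) σ - liouvilleZ (pinnedChain ω₂ 0 0 1) (fun σ => (pinnedChain ω₂ 0 0 1).bondCurrentZ σ 0) σ)) ∘ D₀.flow t)))
            (fun ω => Real.pi * ρ ω) (𝓝[>] (0 : ℝ)) (Set.Ioo (-δ) δ) := by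
  refine stub_freeForceKernel_of_spectralWindow ?_
  intro ω₂ a b hω ha hb hgap D₀ Z₀ hG hcar hsc hΦ
  obtain ⟨m, hm, hK⟩ := freeForceKernel_eq_cosTransform ω₂ a b D₀ Z₀ hsc hΦ
  obtain ⟨m', hm', hcos, δ, hδ, ρ, hρc, hρ0, hρ00, hw⟩ :=
    hwin ω₂ a b hω ha hb hgap D₀ Z₀ hG hcar hsc hΦ m hm hK
  exact ⟨m', hm', fun t => by rw [hK t, hcos t], δ, hδ, ρ, hρc, hρ0, hρ00, hw⟩

end Summit.AtomisticToContinuum.FouriersLaw.Theorems.DrudeDissolution.GramPencilHarmonicChaos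

end
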